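import Summits.AtomisticToContinuum.Crystallization.Theorems.FrustratedLawDichotomyCellHalo
import Summits.AtomisticToContinuum.Crystallization.Theorems.FrustratedLawDichotomyCoherentFloorHaloDialComplete

/-!
# FrustratedLawDichotomy · crux `AperiodicFrustratedLawGap` (stmt-AtomisticToContinuum-27623) — CELL-SOUND V′: THE CLASS-H TWIN ON RADIALLY COMPLETE TEMPLATES
# ((253′) = the tree's `…CellHalo` rows with the radial conjunct of `hin` deleted; FINDING «TEMPLATE-COMPLETENESS» r1861 (A), KFILE amendment E §E1-H;
# decomp-a2c hand-1 g55)

* ★★ `certFloorHL_le_two_mul_rootEnergy_of_nash'` — the label-frame class-H door with `hin := ∀ m ∈ M, ⟪pos m, n⟫ + τ ≤ s` (transfer of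
  `…CoherentFloorHaloDialComplete.certFloorHalo_le_two_mul_rootEnergy_dial_of_nash'` along the tree's `certFloorHalo_image_eq`);
* ★ `rowFloorHalo_of_cells'` — the class-H row packaging for the atlas door over radially complete placed templates.
Everything else of `…CellHalo` (`certFloorHL`, `labOf`, the truncated master `lb_le_certFloorHL_trunc`, `measurableSet_rowHalo`) is reused as is
(no `hin` there).  DEF-FREE; imports TREE `…CellHalo` + `…CoherentFloorHaloDialComplete`; 0 sorry.  All `[folklore]`; nothing here closes an item.
-/

noncomputable section

namespace Summit.AtomisticToContinuum.Crystallization.Theorems.FrustratedLawDichotomyCellHaloComplete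

open MeasureTheory Metric Set RealInnerProductSpace
open scoped BigOperators
open Literature.MathematicalPhysics.StatisticalMechanics (lennardJones rootEnergy)
open Literature.Probability.Process (IsRootedHardCore)
open Summit.AtomisticToContinuum.Crystallization.Theorems.ChargedEnergyGapNegative (E3)
open Summit.AtomisticToContinuum.Crystallization.Theorems.FrustratedLawDichotomyCoherentOn (coherentOn measurableSet_coherentOn)
open Summit.AtomisticToContinuum.Crystallization.Theorems.FrustratedLawDichotomyCoherentFloorAlgebra
open Summit.AtomisticToContinuum.Crystallization.Theorems.FrustratedLawDichotomyCoherentFloor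
open Summit.AtomisticToContinuum.Crystallization.Theorems.FrustratedLawDichotomyCoherentFloorHalo (haloWindow halfCol halfEnergyCol
  measurableSet_haloWindow)
open Summit.AtomisticToContinuum.Crystallization.Theorems.FrustratedLawDichotomyCoherentFloorHaloDialComplete
  (certFloorHalo_le_two_mul_rootEnergy_dial_of_nash')
open Summit.AtomisticToContinuum.Crystallization.Theorems.FrustratedLawDichotomyCellFrame
open Summit.AtomisticToContinuum.Crystallization.Theorems.FrustratedLawDichotomyCellHalo

variable {ι : Type*} [DecidableEq ι]

/-- ★★ **T2-H IN THE LABEL FRAME, WITHOUT THE RADIAL `hin`** ((253′): the tree's `…CellHalo.certFloorHL_le_two_mul_rootEnergy_of_nash` with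
`hin` weakened to its PLANE conjunct `∀ m ∈ M, ⟪pos m, n⟫ + τ ≤ s` — placed tubes may stick out of the ball, never across the level).  Transfer of
`…HaloDialComplete.certFloorHalo_le_two_mul_rootEnergy_dial_of_nash'` along the tree's `certFloorHalo_image_eq`. [folklore] -/
theorem certFloorHL_le_two_mul_rootEnergy_of_nash' {μ : Measure E3} {τ Rc s : ℝ} {n : E3} (M MI : Finset ι) (o : ι) (pos Y : ι → E3)
    (dB dH : ι → ℝ) (hn : ‖n‖ = 1) (hs : 1 ≤ s) (hμ : IsRootedHardCore (7 / 10) μ)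
    (hNash : ∀ p : E3, μ {p} ≠ 0 → ∀ w : E3, (∀ q : E3, μ {q} ≠ 0 → q ≠ p → w ≠ q) →
      ∑' q : {q : E3 // μ {q} ≠ 0 ∧ q ≠ p}, lennardJones (dist p (q : E3)) ≤
        ∑' q : {q : E3 // μ {q} ≠ 0 ∧ q ≠ p}, lennardJones (dist w (q : E3)))
    (hτ0 : 0 ≤ τ) (hτ : 2 * τ < 7 / 10) (hRc : 1 ≤ Rc) (hcoh : μ ∈ coherentOn (M.image pos) τ (haloWindow n s Rc))
    (ho : o ∈ M) (h0 : pos o = 0) (hMI : MI ⊆ M)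
    (hsep : ∀ m ∈ M, ∀ m' ∈ M, m ≠ m' → 2 * τ < dist (pos m) (pos m'))
    (hin : ∀ m ∈ M, ⟪pos m, n⟫ + τ ≤ s)
    (hI : ∀ m ∈ MI, (7 / 20 ≤ dB m ∧ dB m ≤ Rc - (‖pos m‖ + τ)) ∧ (7 / 20 ≤ dH m ∧ dH m ≤ s - (⟪pos m, n⟫ + τ))) :
    certFloorHL M MI o pos Y τ Rc dB dH s ≤ 2 * rootEnergy lennardJones μ := by
  classical
  have hinj : Set.InjOn pos ↑M := by
    intro m hm m' hm' h
    by_contra hne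
    have h1 := hsep m hm m' hm' hne
    rw [h, dist_self] at h1
    linarith
  rw [← certFloorHalo_image_eq hinj ho h0 hMI]
  refine certFloorHalo_le_two_mul_rootEnergy_dial_of_nash' _ _ _ hn hs hμ hNash hτ0 hτ hRc hcoh (Finset.mem_image.2 ⟨o, ho, h0⟩)
    (Finset.image_subset_image hMI) ?_ ?_ ?_
  · intro x hx x' hx' hne
    obtain ⟨m, hm, rfl⟩ := Finset.mem_image.1 hx
    obtain ⟨m', hm', rfl⟩ := Finset.mem_image.1 hx'
    exact hsep m hm m' hm' fun h => hne (by rw [h])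
  · intro x hx
    obtain ⟨m, hm, rfl⟩ := Finset.mem_image.1 hx
    exact hin m hm
  · intro x hx
    obtain ⟨m, hm, rfl⟩ := Finset.mem_image.1 hx
    rw [labOf_pos hinj hMI dB hm, labOf_pos hinj hMI dH hm]
    exact hI m hm

/-- ★ ROW PACKAGING FOR THE ATLAS DOOR, CLASS H, RADIALLY COMPLETE TEMPLATES ((253′): the tree's `rowFloorHalo_of_cells` with the radial
conjunct of `hin` deleted).  Cells take radially complete templates (KFILE amendment E, E2). [folklore] -/
theorem rowFloorHalo_of_cells' {κ : Type*} (B : Set κ) (M MI : Finset ι) (o : ι) (posF YF : κ → ι → E3) (nF : κ → E3) (sF : κ → ℝ)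
    (dBF dHF : κ → ι → ℝ) {τ Rc c mc : ℝ} (hτ0 : 0 ≤ τ) (hτ : 2 * τ < 7 / 10) (hRc : 1 ≤ Rc) (ho : o ∈ M) (hMI : MI ⊆ M)
    (hn : ∀ F ∈ B, ‖nF F‖ = 1) (hs : ∀ F ∈ B, 1 ≤ sF F) (h0 : ∀ F ∈ B, posF F o = 0)
    (hsep : ∀ F ∈ B, ∀ m ∈ M, ∀ m' ∈ M, m ≠ m' → 2 * τ < dist (posF F m) (posF F m'))
    (hin : ∀ F ∈ B, ∀ m ∈ M, ⟪posF F m, nF F⟫ + τ ≤ sF F)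
    (hI : ∀ F ∈ B, ∀ m ∈ MI, (7 / 20 ≤ dBF F m ∧ dBF F m ≤ Rc - (‖posF F m‖ + τ)) ∧
      (7 / 20 ≤ dHF F m ∧ dHF F m ≤ sF F - (⟪posF F m, nF F⟫ + τ)))
    {cUp : ℝ} (hc : c ≤ cUp) (hcert : ∀ F ∈ B, 2 * (cUp + mc) ≤ certFloorHL M MI o (posF F) (YF F) τ Rc (dBF F) (dHF F) (sF F))
    (μ : Measure E3) (hμ : IsRootedHardCore (7 / 10) μ)
    (hNash : ∀ p : E3, μ {p} ≠ 0 → ∀ w : E3, (∀ q : E3, μ {q} ≠ 0 → q ≠ p → w ≠ q) →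
      ∑' q : {q : E3 // μ {q} ≠ 0 ∧ q ≠ p}, lennardJones (dist p (q : E3)) ≤
        ∑' q : {q : E3 // μ {q} ≠ 0 ∧ q ≠ p}, lennardJones (dist w (q : E3)))
    (hrow : μ ∈ ⋃ F ∈ B, coherentOn (M.image (posF F)) τ (haloWindow (nF F) (sF F) Rc)) :
    c + mc ≤ rootEnergy lennardJones μ := by
  obtain ⟨F, hF, hcoh⟩ := Set.mem_iUnion₂.1 hrow
  have h := certFloorHL_le_two_mul_rootEnergy_of_nash' M MI o (posF F) (YF F) (dBF F) (dHF F) (hn F hF) (hs F hF) hμ hNash hτ0 hτ hRc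
    hcoh ho (h0 F hF) hMI (hsep F hF) (hin F hF) (hI F hF)
  linarith [hcert F hF]

end Summit.AtomisticToContinuum.Crystallization.Theorems.FrustratedLawDichotomyCellHaloComplete

end
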